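import Mathlib.RingTheory.Derivation.Basic
import Mathlib.Algebra.BigOperators.Group.Finset.Basic
import Mathlib.Tactic.Positivity
import Mathlib.Tactic.Ring
import Mathlib.Tactic.NormNum
import HarnessLib

/-!
# Weil-transverse obstruction: the semiregularity map kills the derivative of a split all-pure design
# (the algebraic core, kernel-checked; the model ranks are census data)

Family `hodge`, layer `Literature/AlgebraicGeometry/HodgeTheory`. Fully PROVED statements (no named fact, no definition),
in the standard of `WeilClassTestSplitDesigns.lean` / `WeilClassTestPairedDesign.lean`: census ALGEBRA for the
Bloch/Buchweitz–Flenner seed hunt of the ladder note `papers/HodgeConjecture/hodge-weil-ladder` (packet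
`run/shared/lean/b2b/hodge-weil/`, LADDER `## CARVER v8` C64–C66, carver generation 8). It is NOT a case of the Hodge
conjecture, closes no rung, and introduces no fact. What the kernel checks is the one identity that makes the
"Weil-transverse obstruction" of LADDER C64 work; the dictionary and the finite rank data it is applied to are recorded
below as pen-and-paper / script census (`b2b-hweil-carver-g8/ct/ct4/weil_kappa.py`), exactly as in the sibling files.

## The identity (Theorem `sum_smul_pow_smul_apply_eq_zero`)

Let `A` be a commutative `ℚ`-algebra, `M` an `A`-module and `D : A → M` a `ℚ`-derivation. For finitely many
`r a ∈ A` with rational weights `ε a` and an exponent `q`, Leibniz gives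
`(q+1) • Σ_a ε_a • (r_a^q • D r_a) = D (Σ_a ε_a • r_a^{q+1})`.
Hence if the weighted power sum is "pure", `Σ_a ε_a • r_a^{q+1} = π • N^{q+1} + w` with `D N = 0` and `D w = 0`, then
`Σ_a ε_a • (r_a^q • D r_a) = 0`.

## Dictionary (pen-and-paper; conventions (T)(W)(P) of `WeilClassTestSplitDesigns.lean`)

* `Y₀ = A₀ × A₀` a generic tensor point of the weight-(3,3) Weil family `𝒲_d` (`dim 𝒲_d = 9`), `K = ℚ(√-d)` acting by
  `J(x,y) = (−dy, x)`, `NS(Y₀)_ℚ = ⟨θ₁, θ₂, P⟩`, `N = θ₁ + dθ₂`, charged units `x, y`, Weil classes `W = ⟨x³, y³⟩`.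
  `A` := the even, commutative algebra of translation-invariant forms of types `(k,k)` and `(k-1,k+1)` on `Y₀`
  (products of two forms of the second kind vanish in the range used); a first-order deformation
  `κ ∈ H¹(T_{Y₀}) = Hom(H^{1,0}, H^{0,1})` acts as the DERIVATION `D = κ⌟` (contraction), `(k,k) → (k−1,k+1)`.
* A SPLIT DESIGN is `G = ⊕_a L_a[n_a]`, `c₁(L_a) = r_a ∈ NS(Y₀)_ℚ`, `ε_a = (−1)^{n_a}`; `ch(G) = Σ_a ε_a e^{r_a}`. On the
  diagonal block `Ext²(L_a, L_a) = H^{0,2}` the Buchweitz–Flenner semiregularity component is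
  `σ_q(ω) = ω ∧ ε_a r_a^q / q!` [BuchweitzFlenner2003, §§3–4: `σ = Σ_q tr(At(G)^q ∘ −)/q!`, `At(L) = c₁(L)`], so for the
  vector `v_κ := (κ⌟r_a)_a ∈ ⊕_a H^{0,2} ⊂ Ext²(G,G)` one has `q! · σ_q(v_κ) = Σ_a ε_a (κ⌟r_a) ∧ r_a^q`, which is the
  left-hand side of the identity with `D = κ⌟`.
* ALL-PURE: `ch_k(G) ∈ ℚN^k` for `k ≠ 3` and `ch₃(G) ∈ ℚN³ ⊕ W` — the necessary condition for a seed at `Y₀` to be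
  relevant along `𝒲_d` (LADDER C62a). WEIL DIRECTIONS: `T_{Y₀}𝒲_d = {κ : κ⌟N = 0, κJ = Jκ}`; along them `κ⌟N = 0` and
  `κ⌟x³ = κ⌟y³ = 0` (the polarisation and the Weil classes stay Hodge), i.e. `D N = 0`, `D w = 0`.
* CONCLUSION (LADDER C64): for every `κ ∈ T_{Y₀}𝒲_d` and every `q`, `σ_q(v_κ) = 0`: the semiregularity map of an
  all-pure split design kills `v_κ`. CENSUS DATA (script `weil_kappa.py`, exterior model over `ℚ(√-d)`, `d = 1`; not
  kernel-checked here): `dim T𝒲 = 9`, tensor sub-locus `{κ⌟θ₁ = κ⌟θ₂ = κ⌟P = 0}` of dimension `6`, all polarised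
  directions `21`; `κ ↦ v_κ` has rank `3 = 9 − 6` for every design with a charged root (indeed `dim span{κ⌟r} = 3` for
  every single charged root `r`). So `dim ker σ_I ≥ 3` for every `I`: NO split all-pure design at a generic tensor point
  is semiregular — numerically visible as the rank `147/150` of `σ_{1,…,5}` on the definite all-pure `(6,4)` design of
  LADDER C62b. Interpretation (not used): `v_κ = ob_G(κ)` is the obstruction to deforming `G` along `κ`
  [BuchweitzFlenner2003, `σ(ob) = κ⌟ch`]; a semiregular object must be unobstructed along all of `T𝒲_d`, and split
  objects built from `NS(Y₀)`-classes are not (LADDER C66 extends this to twisted complexes of such line bundles).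

Tags: `[model-algebra]` for the theorems (pure commutative algebra), `[census]` for the dictionary and rank data.
No `[claim]`, no fact, no definition.
-/

namespace Literature.AlgebraicGeometry.HodgeTheory.WeilTransverseObstruction

open Finset BigOperators

variable {A : Type*} [CommRing A] [Algebra ℚ A]
variable {M : Type*} [AddCommGroup M] [Module A M] [Module ℚ M]

/-- Leibniz for one root: `(q+1) • (r^q • D r) = D (r^(q+1))`. [folklore] -/
theorem succ_nsmul_pow_smul_apply (D : Derivation ℚ A M) (r : A) (q : ℕ) :
    (q + 1) • (r ^ q • D r) = D (r ^ (q + 1)) := by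
  rw [D.leibniz_pow r (q + 1)]
  simp

/-- Leibniz for a weighted family of roots: `(q+1) • Σ_a ε_a • (r_a^q • D r_a) = D (Σ_a ε_a • r_a^(q+1))`.
In the dictionary: `(q+1)! · σ_q(v_κ) = κ⌟((q+1)! · ch_{q+1}(G))`. [folklore] -/
theorem succ_nsmul_sum_smul_pow_smul_apply {ι : Type*} (D : Derivation ℚ A M) (s : Finset ι)
    (ε : ι → ℚ) (r : ι → A) (q : ℕ) :
    (q + 1) • (∑ a ∈ s, ε a • (r a ^ q • D (r a))) = D (∑ a ∈ s, ε a • r a ^ (q + 1)) := by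
  rw [map_sum, Finset.smul_sum]
  refine Finset.sum_congr rfl ?_
  intro a _
  rw [D.map_smul_of_tower, ← succ_nsmul_pow_smul_apply D (r a) q, smul_comm]

/-- THE KERNEL VECTOR (LADDER C64 (c)). If the weighted power sum of degree `q+1` is pure —
`Σ_a ε_a • r_a^(q+1) = π • N^(q+1) + w` with `D N = 0` and `D w = 0` — then `Σ_a ε_a • (r_a^q • D r_a) = 0`.
In the dictionary: for a split all-pure design and a Weil direction `κ`, `σ_q(v_κ) = 0`
(the use made of it: [cite: BuchweitzFlenner2003, §§3–4 (σ = Σ tr(At^q ∘ −)/q!)]). [folklore] -/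
theorem sum_smul_pow_smul_apply_eq_zero {ι : Type*} (D : Derivation ℚ A M) (s : Finset ι)
    (ε : ι → ℚ) (r : ι → A) (q : ℕ) (π : ℚ) (N w : A)
    (hpure : ∑ a ∈ s, ε a • r a ^ (q + 1) = π • N ^ (q + 1) + w) (hN : D N = 0) (hw : D w = 0) :
    ∑ a ∈ s, ε a • (r a ^ q • D (r a)) = 0 := by
  have h := succ_nsmul_sum_smul_pow_smul_apply D s ε r q
  rw [hpure, map_add, D.map_smul_of_tower, D.leibniz_pow N (q + 1), hN, hw] at h
  simp only [smul_zero, add_zero] at h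
  -- `h : (q+1) • Σ = 0` in a `ℚ`-module: divide by `q+1`.
  have hq : ((q : ℚ) + 1) • (∑ a ∈ s, ε a • (r a ^ q • D (r a))) = 0 := by
    have : ((q : ℚ) + 1) • (∑ a ∈ s, ε a • (r a ^ q • D (r a)))
        = (q + 1) • (∑ a ∈ s, ε a • (r a ^ q • D (r a))) := by
      rw [← Nat.cast_succ, Nat.cast_smul_eq_nsmul]
    rw [this, h]
  have hne : ((q : ℚ) + 1) ≠ 0 := by positivity
  exact (smul_eq_zero.mp hq).resolve_left hne

/-- The same for all degrees at once: if every weighted power sum of positive degree is pure (the component `w k`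
with `D (w k) = 0` is non-zero only in the Weil degree, but that is immaterial), then `v_κ` lies in the kernel of
every `σ_q`. [folklore] -/
theorem sum_smul_pow_smul_apply_eq_zero_all {ι : Type*} (D : Derivation ℚ A M) (s : Finset ι)
    (ε : ι → ℚ) (r : ι → A) (π : ℕ → ℚ) (N : A) (w : ℕ → A)
    (hpure : ∀ k, 1 ≤ k → ∑ a ∈ s, ε a • r a ^ k = π k • N ^ k + w k)
    (hN : D N = 0) (hw : ∀ k, D (w k) = 0) (q : ℕ) :
    ∑ a ∈ s, ε a • (r a ^ q • D (r a)) = 0 :=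
  sum_smul_pow_smul_apply_eq_zero D s ε r q (π (q + 1)) N (w (q + 1))
    (hpure (q + 1) (Nat.succ_le_succ (Nat.zero_le q))) hN (hw (q + 1))

/-- Sanity instance of the dictionary's simplest case (`q = 0`, the trace component `σ₀`): if `Σ ε_a r_a = π N + w`
with `D N = D w = 0` then `Σ ε_a D r_a = 0` — for a split design this is `κ⌟c₁(G) = 0`. -/
example {ι : Type*} (D : Derivation ℚ A M) (s : Finset ι) (ε : ι → ℚ) (r : ι → A) (π : ℚ) (N w : A)
    (hpure : ∑ a ∈ s, ε a • r a = π • N + w) (hN : D N = 0) (hw : D w = 0) :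
    ∑ a ∈ s, ε a • D (r a) = 0 := by
  have := sum_smul_pow_smul_apply_eq_zero D s ε r 0 π N w (by simpa using hpure) hN hw
  simpa using this

end Literature.AlgebraicGeometry.HodgeTheory.WeilTransverseObstruction
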